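import Mathlib
import HarnessLib
import Summits.NavierStokesRegularity.NavierStokesRegularity.Theorems.HalfSpaceWindowDoorCirculationCarryingRigidityDefs
import Summits.NavierStokesRegularity.NavierStokesRegularity.Theorems.HalfSpaceWindowDoorCirculationCarryingRigidityRotHeadLiouville
import Summits.NavierStokesRegularity.NavierStokesRegularity.Theorems.HalfSpaceWindowDoorCirculationCarryingRigidityAsymptoticPlanarity
import Summits.NavierStokesRegularity.NavierStokesRegularity.Theorems.PoloidalWindowDoorPoloidalWindowRigidityWindow
import Summits.NavierStokesRegularity.NavierStokesRegularity.Theorems.PoloidalWindowDoorPoloidalWindowRigidityClassSpaceTimeRates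
import Summits.NavierStokesRegularity.NavierStokesRegularity.Theorems.QuantisedSymmetryPolyhedralDssProfileExistsStubAncientMildOfClassicalTypeI
import Literature.Analysis.FluidPDE.TypeIAncientMildClassical
import Literature.Analysis.FluidPDE.PineauVicolRSS
import Literature.Analysis.FluidPDE.PineauVicolRSSChaeWolf
import Literature.Analysis.FluidPDE.PineauVicolRDSSLeray
import Literature.Analysis.FluidPDE.AxisymmetricVorticityTransport

/-!
# Route `HalfSpaceWindowDoor`, crux `CirculationCarryingRigidity` (stmt-NavierStokesRegularity-25311) — line
# `rot_bernoulli`, VI: the theorem IN PINEAU–VICOL'S OWN SETTING — their Conjecture 1.1 holds for EVERY angular speed in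
# the counter-rotating closed-hemisphere class

LEAD ns-hsw-p1 g11 (cell pub-ns-dss).  Pineau–Vicol (arXiv:2607.09619) Theorem 1.4 = tree `pineauVicol2026_rss_liouville`
(discharged): a classical Navier–Stokes solution on `ℝ³ × [−1,0)` with the Type I bound (1.10) `|u(x,t)| ≤ C₀/(|x| + √(−t))`
which is backwards rotated self-similar, `u = pvAnsatz α U` ((1.7): `u(x,t) = (−t)^{−1/2} R(αs) U(R(−αs)x/√(−t))`,
`s = −log(−t)`), has `U ≡ 0` provided `|α| < α₁(C₀)` or `|α| > α₂(C₀)`; their Conjecture 1.1 (= Tsai GSM 192 Conj. 8.9)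
asks this for every `α ≠ 0`.  THIS FILE, same hypotheses WITHOUT any size condition on `α` (and without the `C²` hypothesis
on `U`, automatic here), under the SIGN condition of the door:

* `rss_profile_eq_zero_of_counterRotating` — if the vertical vorticity of the profile is one-signed, `(curl U)₂ ≥ 0`, and
  `α ≤ 0`, then `U = 0`.  (By the reflection `x₁ ↦ −x₁` the case `(curl U)₂ ≤ 0`, `α ≥ 0` is the same statement: what is
  excluded is COUNTER-ROTATION of the pattern against its one-signed vertical vorticity, at any speed.)

Ingredients proved here: Rodrigues' formula `R(θ) = 1 + sin θ·J + (1 − cos θ)·J²` (`rotZL_eq_rodrigues`, `J = e₃×`),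
`d/dθ R(θ) = cos θ·J + sin θ·J²` (`hasDerivAt_rotZL`), the INSTANTANEOUS ROTATED SELF-SIMILARITY of the ansatz
`∂ₜ(pvAnsatz α U)(−1,x) = ½U + ½DU·x + α(JU − DU(Jx))` (`hasDerivAt_pvAnsatz_neg_one`), and the door-class assembly with
the sign ON THE SLICE `t = −1` ONLY (`eq_zero_of_instantRSS_sliceSign`: the class is classical on windows,
`IsTypeIAncientMild.exists_isClassicalNSSolutionOn_Ioo`; the classical pressure has the gradient rate
`…ClassSpaceTimeRates.exists_pressureGradient_rate_of_class`, hence grows linearly at `t = −1`; the momentum equation at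
`t = −1` with `∂ₜv` replaced by the generator IS the rotated Leray system (1.8); `…RotHeadLiouville.exists_eq_const_of_rotProfile_signE3`
makes the slice constant and ONE translation-invariant slice kills, `…AsymptoticPlanarity.eq_zero_of_lineInvariant_slice`);
`eq_zero_of_pvAnsatz_sliceSign`.  Chain from PV's setting (all tree): backward extension of the ansatz field to `(−∞,0)`
(footnote 13, `exists_isClassicalNSSolutionOn_Iio_of_isRotatedDSS ∘ isRotatedDSS_pvAnsatz`), Type I on `t < 0` (Remark 1.2,
`norm_pvAnsatz_le_of_profile ∘ profile_bound_of_typeI`), KNSS gauge (`isTypeIAncientMild_of_classical_typeI`).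

WHAT THIS IS NOT: not a statement about Navier–Stokes regularity (Clay A); RSS profiles are HYPOTHETICAL blow-up profiles;
helper `--supports` 25311 (census of W6: the counter-rotating RSS stratum is empty in PV's formulation too); the item stays
OPEN at its research stub; nothing is claimed about the co-rotating case `α > 0` with `(curl U)₂ ≥ 0`.
-/

noncomputable section

-- the summit and its single sub-problem share the name (CONVENTIONS §1), as in every Theorems file
set_option linter.dupNamespace false

namespace Summit.NavierStokesRegularity.NavierStokesRegularity.Theorems.HalfSpaceWindowDoorCirculationCarryingRigidityRotHeadPV

open Set Function Filter Topology InnerProductSpace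
open scoped RealInnerProductSpace Laplacian ContDiff
open Literature.Analysis Literature.Analysis.FluidPDE Literature.Analysis.FluidPDE.PineauVicol2026
open Summit.NavierStokesRegularity.NavierStokesRegularity.Theorems.HalfSpaceWindowDoorCirculationCarryingRigidityDefs
  (InDoorClass SignE3 e3 HemisphereLiouvilleE3)
open Summit.NavierStokesRegularity.NavierStokesRegularity.Theorems.HalfSpaceWindowDoorCirculationCarryingRigidityRotHeadLiouville
  (exists_eq_const_of_rotProfile_signE3)
open Summit.NavierStokesRegularity.NavierStokesRegularity.Theorems.HalfSpaceWindowDoorCirculationCarryingRigidityAsymptoticPlanarity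
  (eq_zero_of_lineInvariant_slice)
open Summit.NavierStokesRegularity.NavierStokesRegularity.Theorems.PoloidalWindowDoorPoloidalWindowRigidityWindow
  (isTypeIAncientMild_of_class)
open Summit.NavierStokesRegularity.NavierStokesRegularity.Theorems.PoloidalWindowDoorPoloidalWindowRigidityClassSpaceTimeRates
  (exists_pressureGradient_rate_of_class)
open Summit.NavierStokesRegularity.NavierStokesRegularity.Theorems.PolyhedralDssProfileExists.Birth
  (isTypeIAncientMild_of_classical_typeI)

/-! ### Rodrigues' formula and the derivative of the rotation group -/

/-- **Rodrigues' formula** for the rotations about the vertical axis: `R(θ) = 1 + sin θ·J + (1 − cos θ)·J²`, `J = e₃×`. -/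
theorem rotZL_eq_rodrigues (θ : ℝ) :
    rotZL θ = ContinuousLinearMap.id ℝ (EuclideanSpace ℝ (Fin 3)) + Real.sin θ • rotGenL +
      (1 - Real.cos θ) • rotGenL.comp rotGenL := by
  ext x i
  fin_cases i <;> simp [rotZ, rotGen] <;> ring

/-- **The derivative of the rotation group**: `d/dθ R(θ) = cos θ·J + sin θ·J²` (as continuous linear maps). -/
theorem hasDerivAt_rotZL (θ₀ : ℝ) :
    HasDerivAt (fun θ => rotZL θ) (Real.cos θ₀ • rotGenL + Real.sin θ₀ • rotGenL.comp rotGenL) θ₀ := by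
  have h1 := (Real.hasDerivAt_sin θ₀).smul_const
    (rotGenL : EuclideanSpace ℝ (Fin 3) →L[ℝ] EuclideanSpace ℝ (Fin 3))
  have h2 := ((hasDerivAt_const θ₀ (1 : ℝ)).sub (Real.hasDerivAt_cos θ₀)).smul_const
    ((rotGenL : EuclideanSpace ℝ (Fin 3) →L[ℝ] EuclideanSpace ℝ (Fin 3)).comp rotGenL)
  have h3 := ((hasDerivAt_const θ₀ (ContinuousLinearMap.id ℝ (EuclideanSpace ℝ (Fin 3)))).add h1).add h2
  have h4 : HasDerivAt (fun θ : ℝ => rotZL θ)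
      (0 + Real.cos θ₀ • rotGenL + (0 - -Real.sin θ₀) • rotGenL.comp rotGenL) θ₀ :=
    h3.congr_of_eventuallyEq (Eventually.of_forall fun θ => by
      simp only [Pi.add_apply, Pi.sub_apply]
      exact rotZL_eq_rodrigues θ)
  refine h4.congr_deriv ?_
  rw [zero_add, zero_sub, neg_neg]

/-! ### The time derivative of the ansatz field at `t = −1` -/

/-- **The RSS ansatz is instantaneously rotated self-similar**: for a differentiable time-independent profile `U`,
`∂ₜ (pvAnsatz α U)(−1, x) = ½U(x) + ½ DU(x)x + α (J U(x) − DU(x)(J x))`. -/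
theorem hasDerivAt_pvAnsatz_neg_one {α : ℝ} {U : EuclideanSpace ℝ (Fin 3) → EuclideanSpace ℝ (Fin 3)}
    (hU : Differentiable ℝ U) (x : EuclideanSpace ℝ (Fin 3)) :
    HasDerivAt (fun t => pvAnsatz α (fun y _ => U y) t x)
      ((1 / 2 : ℝ) • U x + (1 / 2 : ℝ) • fderiv ℝ U x x + α • (rotGen (U x) - fderiv ℝ U x (rotGen x))) (-1) := by
  -- the scalar factor `c(t) = (√(−t))⁻¹`: `c(−1) = 1`, `c'(−1) = ½`
  have hneg : HasDerivAt (fun t : ℝ => -t) (-1) (-1) := hasDerivAt_neg' (-1)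
  have hs1 : Real.sqrt (-(-1 : ℝ)) = 1 := by rw [neg_neg, Real.sqrt_one]
  have hc : HasDerivAt (fun t : ℝ => (Real.sqrt (-t))⁻¹) (1 / 2) (-1) := by
    have h2 : HasDerivAt (fun t : ℝ => Real.sqrt (-t)) ((-1) / (2 * Real.sqrt (-(-1)))) (-1) :=
      hneg.sqrt (by norm_num)
    have h3 := h2.inv (by rw [hs1]; norm_num)
    refine h3.congr_deriv ?_
    rw [hs1]
    norm_num
  -- the angle `θ(t) = α·(−log(−t))`: `θ(−1) = 0`, `θ'(−1) = α`
  have hθ0 : α * -Real.log (-(-1 : ℝ)) = 0 := by simp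
  have hθ : HasDerivAt (fun t : ℝ => α * -Real.log (-t)) α (-1) := by
    have h1 : HasDerivAt (fun t : ℝ => Real.log (-t)) ((-(-1 : ℝ))⁻¹ * (-1)) (-1) :=
      (Real.hasDerivAt_log (by norm_num : (-(-1 : ℝ)) ≠ 0)).comp (-1) hneg
    have h2 := (h1.neg).const_mul α
    refine h2.congr_deriv ?_
    norm_num
  -- the rotations `A(t) = R(θ(t))`, `B(t) = R(−θ(t))`
  have hA : HasDerivAt (fun t : ℝ => rotZL (α * -Real.log (-t))) (α • rotGenL) (-1) := by
    have h := (hasDerivAt_rotZL (α * -Real.log (-(-1 : ℝ)))).scomp (-1) hθ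
    simp only [hθ0, Real.cos_zero, Real.sin_zero, one_smul, Function.comp_def] at h
    exact h.congr_deriv (by ext v i; simp)
  have hB : HasDerivAt (fun t : ℝ => rotZL (-(α * -Real.log (-t)))) ((-α) • rotGenL) (-1) := by
    have hθn : HasDerivAt (fun t : ℝ => -(α * -Real.log (-t))) (-α) (-1) := hθ.neg
    have h := (hasDerivAt_rotZL (-(α * -Real.log (-(-1 : ℝ))))).scomp (-1) hθn
    simp only [hθ0, neg_zero, Real.cos_zero, Real.sin_zero, one_smul, Function.comp_def] at h
    exact h.congr_deriv (by ext v i; simp)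
  -- the moving point `z(t) = R(−θ(t)) (c(t) x)`: `z(−1) = x`, `z'(−1) = −α Jx + ½ x`
  have hw : HasDerivAt (fun t : ℝ => (Real.sqrt (-t))⁻¹ • x) ((1 / 2 : ℝ) • x) (-1) := hc.smul_const x
  have hz : HasDerivAt (fun t : ℝ => rotZL (-(α * -Real.log (-t))) ((Real.sqrt (-t))⁻¹ • x))
      (((-α) • rotGenL) ((Real.sqrt (-(-1 : ℝ)))⁻¹ • x) + rotZL (-(α * -Real.log (-(-1 : ℝ)))) ((1 / 2 : ℝ) • x))
      (-1) := hB.clm_apply hw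
  have hz1 : rotZL (-(α * -Real.log (-(-1 : ℝ)))) ((Real.sqrt (-(-1 : ℝ)))⁻¹ • x) = x := by
    rw [hθ0, neg_zero, hs1, inv_one, one_smul, rotZL_apply, rotZ_zero]
  -- `W(t) = U(z(t))`
  have hW : HasDerivAt (fun t : ℝ => U (rotZL (-(α * -Real.log (-t))) ((Real.sqrt (-t))⁻¹ • x)))
      (fderiv ℝ U x (((-α) • rotGenL) ((Real.sqrt (-(-1 : ℝ)))⁻¹ • x) +
        rotZL (-(α * -Real.log (-(-1 : ℝ)))) ((1 / 2 : ℝ) • x))) (-1) := by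
    have hUx : HasFDerivAt U (fderiv ℝ U x) (rotZL (-(α * -Real.log (-(-1 : ℝ)))) ((Real.sqrt (-(-1 : ℝ)))⁻¹ • x)) := by
      rw [hz1]
      exact (hU x).hasFDerivAt
    exact hUx.comp_hasDerivAt (-1) hz
  -- `G(t) = R(θ(t)) W(t)` and `F(t) = c(t) G(t)`
  have hG := hA.clm_apply hW
  have hF := hc.smul hG
  -- identify the function and the derivative
  have hfun : (fun t => pvAnsatz α (fun y _ => U y) t x) =
      fun t : ℝ => (Real.sqrt (-t))⁻¹ • rotZL (α * -Real.log (-t))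
        (U (rotZL (-(α * -Real.log (-t))) ((Real.sqrt (-t))⁻¹ • x))) := by
    funext t
    simp only [pvAnsatz, rotZL_apply]
  rw [hfun]
  refine hF.congr_deriv ?_
  rw [hz1]
  simp only [hθ0, hs1, neg_zero, inv_one, one_smul, rotZL_apply, rotZ_zero, _root_.smul_apply, rotGenL_apply,
    map_add, map_smul]
  simp only [smul_sub, neg_smul]
  abel

/-! ### Door-class assembly with the sign on one slice -/

variable {C : ℝ} {v : ℝ → EuclideanSpace ℝ (Fin 3) → EuclideanSpace ℝ (Fin 3)}

/-- **Instantaneous counter-rotating self-similarity kills — sign on ONE slice.**  As `…RotHeadInstant.eq_zero_of_instantRSS`,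
but with the closed-hemisphere condition imposed on the slice `t = −1` only: a door-class profile with `(curl v(−1))₂ ≥ 0` and
`∂ₜv(−1,y) = ½v(−1,y) + ½(y·∇)v(−1,y) + α(e₃×v(−1,y) − ((e₃×y)·∇)v(−1,y))`, `α ≤ 0`, vanishes on the slab. -/
theorem eq_zero_of_instantRSS_sliceSign (hv : InDoorClass C v) (hsign : ∀ y, 0 ≤ curl (v (-1)) y 2) {α : ℝ}
    (hα : α ≤ 0)
    (hgen : ∀ y, deriv (fun τ => v τ y) (-1) = (1 / 2 : ℝ) • v (-1) y + (1 / 2 : ℝ) • fderiv ℝ (v (-1)) y y +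
      α • (rotGen (v (-1) y) - fderiv ℝ (v (-1)) y (rotGen y))) :
    ∀ t < 0, ∀ x, v t x = 0 := by
  obtain ⟨hrate, hcont, hmild, hdiv⟩ := hv
  have hA : IsTypeIAncientMild C v := isTypeIAncientMild_of_class hrate hcont hmild hdiv
  have h1 : (-1 : ℝ) < 0 := by norm_num
  have hmem : (-1 : ℝ) ∈ Ioo (-2 : ℝ) 0 := ⟨by norm_num, by norm_num⟩
  set U : EuclideanSpace ℝ (Fin 3) → EuclideanSpace ℝ (Fin 3) := v (-1) with hU
  have hU3 : ContDiff ℝ 3 U := contDiff_infty.1 (hA.contDiff_slice h1) 3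
  have hdivU : VectorCalculus.IsDivFree U := hdiv (-1) h1
  have hUbdd : ∃ M : ℝ, ∀ y, ‖U y‖ ≤ M := ⟨C, fun y => by
    have h := hA.norm_le h1 y
    rwa [neg_neg, Real.sqrt_one, div_one] at h⟩
  -- classical pressure on `(−2,0)`, its gradient rate and linear growth at `t = −1`
  obtain ⟨p, hns⟩ := hA.exists_isClassicalNSSolutionOn_Ioo (t₀ := -2) (by norm_num)
  obtain ⟨K, hK0, hK⟩ := exists_pressureGradient_rate_of_class hrate hcont hmild
  have hgradK : ∀ y, ‖gradient (p (-1)) y‖ ≤ K := fun y => by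
    have h := hK (-2) p hns (-1) hmem y
    rwa [neg_neg, Real.sqrt_one, mul_one, div_one] at h
  have hP2 : ContDiff ℝ 2 (p (-1)) := (hns.contDiff_pressure hmem).of_le (by norm_cast)
  have hPd : Differentiable ℝ (p (-1)) := (hP2.of_le one_le_two).differentiable one_ne_zero
  have hfd : ∀ z, ‖fderiv ℝ (p (-1)) z‖ ≤ K := fun z => by
    refine ContinuousLinearMap.opNorm_le_bound _ hK0 fun w => ?_
    have h : fderiv ℝ (p (-1)) z w = ⟪gradient (p (-1)) z, w⟫ := by
      rw [gradient, InnerProductSpace.toDual_symm_apply]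
    rw [h]
    exact (abs_real_inner_le_norm _ _).trans (mul_le_mul_of_nonneg_right (hgradK z) (norm_nonneg _))
  have hPpoly : ∃ K' : ℝ, ∃ N : ℕ, ∀ y, |p (-1) y| ≤ K' * (1 + ‖y‖) ^ N := by
    refine ⟨|p (-1) 0| + K, 1, fun y => ?_⟩
    have hmv : ‖p (-1) y - p (-1) 0‖ ≤ K * ‖y - 0‖ :=
      (convex_univ).norm_image_sub_le_of_norm_fderiv_le (fun z _ => hPd z) (fun z _ => hfd z) (mem_univ 0) (mem_univ y)
    rw [sub_zero, Real.norm_eq_abs] at hmv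
    have h2 : |p (-1) y| ≤ |p (-1) 0| + K * ‖y‖ := by
      have := abs_sub_abs_le_abs_sub (p (-1) y) (p (-1) 0)
      linarith
    rw [pow_one]
    nlinarith [abs_nonneg (p (-1) 0), norm_nonneg y]
  -- the rotated Leray system at the slice
  have heq : ∀ y, -((1 : ℝ) • (Δ U) y) + (1 / 2 : ℝ) • U y + (1 / 2 : ℝ) • fderiv ℝ U y y + convect U U y +
      gradient (p (-1)) y + α • (rotGenL (U y) - fderiv ℝ U y (rotGenL y)) = 0 := fun y => by
    have hmom := hns.momentum (-1) hmem y
    simp only [one_smul, Pi.zero_apply, add_zero] at hmom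
    have htd : timeDerivWithin (Ioo (-2 : ℝ) 0) v (-1) y = deriv (fun τ => v τ y) (-1) := by
      rw [timeDerivWithin, derivWithin_of_isOpen isOpen_Ioo hmem]
    rw [htd, hgen y] at hmom
    rw [← sub_eq_zero] at hmom
    rw [one_smul, rotGenL_apply, rotGenL_apply, ← hmom]
    abel
  obtain ⟨c, hc⟩ := exists_eq_const_of_rotProfile_signE3 one_pos (by norm_num : (0 : ℝ) < 1 / 2) hU3 hP2 hdivU heq
    hUbdd hPpoly hα hsign
  have he3 : e3 ≠ 0 := fun h => by
    have h2 := congrArg (fun w : EuclideanSpace ℝ (Fin 3) => w 2) h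
    simp [e3] at h2
  exact eq_zero_of_lineInvariant_slice hA h1 he3 fun x θ => by
    change U (x + θ • e3) = U x
    rw [hc, hc]

/-- **Rotated-self-similar door-class profiles with `α ≤ 0` and one-signed slice vorticity vanish** (as
`…RotHeadAnsatz.eq_zero_of_pvAnsatz`, sign on the profile only). -/
theorem eq_zero_of_pvAnsatz_sliceSign (hv : InDoorClass C v) {α : ℝ} (hα : α ≤ 0)
    {U : EuclideanSpace ℝ (Fin 3) → EuclideanSpace ℝ (Fin 3)} (hsign : ∀ y, 0 ≤ curl U y 2)
    (hform : ∀ t < 0, ∀ x, v t x = pvAnsatz α (fun y _ => U y) t x) :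
    ∀ t < 0, ∀ x, v t x = 0 := by
  have hA : IsTypeIAncientMild C v := isTypeIAncientMild_of_class hv.1 hv.2.1 hv.2.2.1 hv.2.2.2
  have h1 : (-1 : ℝ) < 0 := by norm_num
  have hUeq : U = v (-1) := funext fun y => by rw [hform (-1) h1 y, pvAnsatz_neg_one]
  have hUd : Differentiable ℝ U := by
    rw [hUeq]
    exact (contDiff_infty.1 (hA.contDiff_slice h1) 1).differentiable one_ne_zero
  have hgen : ∀ y, deriv (fun τ => v τ y) (-1) = (1 / 2 : ℝ) • v (-1) y + (1 / 2 : ℝ) • fderiv ℝ (v (-1)) y y +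
      α • (rotGen (v (-1) y) - fderiv ℝ (v (-1)) y (rotGen y)) := fun y => by
    have hd := hasDerivAt_pvAnsatz_neg_one (α := α) hUd y
    have hev : (fun τ => v τ y) =ᶠ[𝓝 (-1 : ℝ)] fun τ => pvAnsatz α (fun z _ => U z) τ y :=
      Filter.mem_of_superset (Iio_mem_nhds h1) fun τ hτ => hform τ hτ y
    rw [(hd.congr_of_eventuallyEq hev).deriv, hUeq]
  have hsign' : ∀ y, 0 ≤ curl (v (-1)) y 2 := fun y => by rw [← hUeq]; exact hsign y
  exact eq_zero_of_instantRSS_sliceSign hv hsign' hα hgen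

/-- **Pineau–Vicol's Conjecture 1.1 in the counter-rotating closed-hemisphere class, every angular speed.**  Let `(u, p)` be
a classical solution of Navier–Stokes (`ν = 1`, no force) on `ℝ³ × [−1, 0)` obeying the Type I bound (1.10)
`‖u(t,x)‖ ≤ C₀/(‖x‖ + √(−t))`, which is backwards rotated self-similar about the vertical axis with angular speed `α` and
profile `U`: `u = pvAnsatz α U` on `[−1,0)` ((1.7): `u(x,t) = (−t)^{−1/2} R(αs) U(R(−αs)x/√(−t))`, `s = −log(−t)`).  If the
vertical vorticity of the profile is one-signed, `(curl U)₂ ≥ 0`, and `α ≤ 0`, then `U = 0`.  (Pineau–Vicol Thm 1.4 gives the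
sign-free conclusion for `|α| < α₁(C₀)` and `|α| > α₂(C₀)`.) -/
theorem rss_profile_eq_zero_of_counterRotating {α C₀ : ℝ} {u : ℝ → EuclideanSpace ℝ (Fin 3) → EuclideanSpace ℝ (Fin 3)}
    {p : ℝ → EuclideanSpace ℝ (Fin 3) → ℝ} {U : EuclideanSpace ℝ (Fin 3) → EuclideanSpace ℝ (Fin 3)}
    (hsol : IsClassicalNSSolutionOn (Ico (-1) 0) 1 0 u p)
    (hI : ∀ t ∈ Ico (-1 : ℝ) 0, ∀ x : EuclideanSpace ℝ (Fin 3), ‖u t x‖ ≤ C₀ / (‖x‖ + Real.sqrt (-t)))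
    (hans : ∀ t ∈ Ico (-1 : ℝ) 0, ∀ x : EuclideanSpace ℝ (Fin 3), u t x = pvAnsatz α (fun y _ => U y) t x)
    (hα : α ≤ 0) (hsign : ∀ y, 0 ≤ curl U y 2) : U = 0 := by
  -- the ansatz field on all of `t < 0` is a classical Type-I solution, hence a door-class profile
  set w : ℝ → EuclideanSpace ℝ (Fin 3) → EuclideanSpace ℝ (Fin 3) := pvAnsatz α (fun y _ => U y) with hw
  obtain ⟨P, hP⟩ := exists_isClassicalNSSolutionOn_Iio_of_isRotatedDSS hsol one_lt_two
    (isRotatedDSS_pvAnsatz (α := α) (U := fun y _ => U y) two_pos fun _ _ => rfl) hans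
  have hIw : HasTypeIDecay C₀ w := fun t ht x =>
    norm_pvAnsatz_le_of_profile (profile_bound_of_typeI hI hans) ht x
  have hA : IsTypeIAncientMild C₀ w := isTypeIAncientMild_of_classical_typeI hP hIw
  have hv : InDoorClass C₀ w :=
    ⟨hA.hasTypeITimeDecay, hA.continuousOn_uncurry, fun s t hst ht x => hA.mild_eq_heatExtension hst ht x,
      fun t ht => hA.isDivFree ht⟩
  have hz := eq_zero_of_pvAnsatz_sliceSign hv hα hsign (fun t _ x => rfl)
  funext y
  have h := hz (-1) (by norm_num) y
  rw [hw, pvAnsatz_neg_one] at h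
  simpa using h

end Summit.NavierStokesRegularity.NavierStokesRegularity.Theorems.HalfSpaceWindowDoorCirculationCarryingRigidityRotHeadPV

end
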